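import Literature.MathematicalPhysics.QuantumFieldTheory.Balaban1983to89.T3ContinuumYM3Torus
import Literature.MathematicalPhysics.QuantumFieldTheory.Balaban1983to89.T4AxialGaugeSmallField
import Mathlib.Algebra.Order.Chebyshev
import HarnessLib

/-!
# LINE 30 «CurvaturePoincare» — the GAUGE-CHOICE TRANSFER door for `stub_curvaturePinning` (NP): from a bond-`ℓ²` bound in ANY gauge to
# `|f(U) − f(𝟙)|`

Crux of record `PoincareLipschitz.MesoscopicConcentrationL` (stmt-QuantumFields-23532; LINE 30 skeleton `Cruxes/HistoryTailL/Lines/curvature_poincare.lean`,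
sha16 e95b7bfb5ac8bc91, ideator ym-r3-idea-2 g16); cell `ym3-torus` (YM ladder rung R3 = continuum `SU(2)` Yang–Mills on T³ — a RUNG, NOT the Clay problem);
width seat `ym3-torus-px16` gen 11 (the (D) pen ✓p739571, whose chain this file frees from the axial gauge).  Helper `--supports stmt-QuantumFields-23532`.

WHAT.  For a box of side `n` at `x₀` and an observable `f` that is GAUGE-INVARIANT, BOX-LOCAL (reads only the bonds with both ends in the `ZMod` box
`{s | (s k − x₀ k).val < n ∀k}`) and `Λ`-link-Lipschitz, and for EVERY gauge transformation `g`: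
  `|f U − f 𝟙| ≤ Λ·√(Σ_{b : both ends in the ZMod box} dist₁((U^g) b)²)`   (★★ `abs_sub_one_le_sqrt_sum_gaugeAct`),
hence `|f U − f 𝟙| ≤ Λ·B` as soon as SOME gauge copy has box-bond energy `≤ B²` (★★ `abs_sub_one_le_of_gauge_sq_le`), and in NP's currency
`|f U − f 𝟙| ≤ Λ·(C·n)·√S` as soon as some gauge copy has box-bond energy `≤ (C·n)²·S` (★★ `abs_sub_one_le_curvature_form`) — so the `min_g` of the NP card
is «pick the best `g`», no minimiser, no measurability, no small-field hypothesis.  PROOF: `f U = f (U^g)` (invariance); box-locality replaces `U^g` by its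
cut-off `W` (`U^g` on the ZMod-box bonds, `1` elsewhere); the Lipschitz row against `𝟙`; `dist₁ 1 = 0` off the box (`Finset.sum_filter`).
Engines that produce their bound on pv26's `boxBonds x₀.val (x₀.val + (n−1))` pass to the ZMod box through ✓`CombPeierlsStubAxialCombTransfer.mem_boxBonds_of_val_lt`
(that module imports the route file, so it is deliberately NOT imported here: this door is route-independent).  §3 is the generic CONGESTION Cauchy–Schwarz row
of the «averaged axial gauges» road (px19 g9): `a_b ≤ Σ_{p∈S b} c_p`, `#S b ≤ m`, `#{b | p ∈ S b} ≤ cong p` ⟹ `Σ_b a_b² ≤ m·Σ_p cong p·c_p²`.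

HONEST SCOPE.  Deterministic transfer bookkeeping (the (D) chain with the gauge left free); proves NOTHING of NP's engine (the `ℓ²` comb ∕ averaged-axial-gauge
bound `Σ_b dist₁((U^g) b)² ≤ C²n²·Σ_p dist₁(U(∂p))²` — px19 g9's road), LM, B♯, MD, K1 23532, `HistoryTailL` 19936, 23083, EX 19200, 20520 or rung R3;
R3 = YM₃ on T³ — NOT d = 4, NOT infinite volume, NOT a mass gap, NOT Clay; the Yang–Mills mass gap is NOT proved.  THEOREMS ONLY (0 `def`, 0 `sorry`).

References: K. Uhlenbeck, CMP 83 (1982) 31–42 [Uhlenbeck1982] (the continuum curvature-pinning this line discretises); M. Creutz, «Quarks, gluons and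
lattices» (1983) ch. 9 [folklore] (axial ∕ maximal-tree gauges).
-/

set_option autoImplicit false

open scoped BigOperators
open Literature.MathematicalPhysics.QuantumFieldTheory.Balaban1983to89
open Literature.MathematicalPhysics.QuantumFieldTheory.Balaban1983to89.T3ContinuumYM3Torus

namespace Summit.QuantumFields.YangMills.Theorems.CurvaturePoincareGaugeTransfer

section Generic

variable {P : Params} {j : ℕ} {G : Type*} [GaugeGroup G]

/-- ★★ **GAUGE-CHOICE TRANSFER.**  For a gauge-invariant, box-local (ZMod box of side `n` at `x₀`), `Λ`-link-Lipschitz `f` (`0 ≤ Λ`) and ANY gauge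
transformation `g`: `|f U − f 𝟙| ≤ Λ·√(Σ_{b : both ends in the box} dist₁((U^g) b)²)` (no sign hypothesis on `Λ` needed). [folklore] -/
theorem abs_sub_one_le_sqrt_sum_gaugeAct {n : ℕ} (x₀ : Site P j) (f : GaugeField P j G → ℝ) {Λ : ℝ}
    (hfG : GaugeField.GaugeInvariant f)
    (hloc : ∀ U U' : GaugeField P j G,
      (∀ b : PBond P j, (∀ k, (b.src k - x₀ k).val < n) → (∀ k, (b.tgt k - x₀ k).val < n) → U b = U' b) → f U = f U')
    (hlip : ∀ U U' : GaugeField P j G, |f U - f U'| ≤ Λ * Real.sqrt (∑ b : PBond P j, GaugeGroup.dist1 (U b * (U' b)⁻¹) ^ 2))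
    (U : GaugeField P j G) (g : GaugeTransf P j G) :
    |f U - f (fun _ => 1)| ≤ Λ * Real.sqrt (∑ b ∈ Finset.univ.filter
      (fun b : PBond P j => (∀ k, (b.src k - x₀ k).val < n) ∧ (∀ k, (b.tgt k - x₀ k).val < n)),
        GaugeGroup.dist1 (GaugeField.gaugeAct g U b) ^ 2) := by
  classical
  set V : GaugeField P j G := GaugeField.gaugeAct g U with hV
  set W : GaugeField P j G := fun b =>
    if (∀ k, (b.src k - x₀ k).val < n) ∧ (∀ k, (b.tgt k - x₀ k).val < n) then V b else 1 with hW
  have hfU : f U = f W := by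
    rw [← hfG g U]
    refine hloc _ _ fun b hs ht => ?_
    have hWb : W b = V b := if_pos ⟨hs, ht⟩
    rw [hWb]
  have hsum : ∑ b : PBond P j, GaugeGroup.dist1 (W b * ((fun _ => (1 : G)) b)⁻¹) ^ 2
      = ∑ b ∈ Finset.univ.filter (fun b : PBond P j => (∀ k, (b.src k - x₀ k).val < n) ∧ (∀ k, (b.tgt k - x₀ k).val < n)),
          GaugeGroup.dist1 (V b) ^ 2 := by
    rw [← Finset.sum_filter_add_sum_filter_not Finset.univ
      (fun b : PBond P j => (∀ k, (b.src k - x₀ k).val < n) ∧ (∀ k, (b.tgt k - x₀ k).val < n))]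
    have h1 : ∑ b ∈ Finset.univ.filter (fun b : PBond P j => (∀ k, (b.src k - x₀ k).val < n) ∧ (∀ k, (b.tgt k - x₀ k).val < n)),
        GaugeGroup.dist1 (W b * ((fun _ => (1 : G)) b)⁻¹) ^ 2
        = ∑ b ∈ Finset.univ.filter (fun b : PBond P j => (∀ k, (b.src k - x₀ k).val < n) ∧ (∀ k, (b.tgt k - x₀ k).val < n)),
          GaugeGroup.dist1 (V b) ^ 2 := by
      refine Finset.sum_congr rfl fun b hb => ?_
      have hb' := (Finset.mem_filter.1 hb).2
      have hWb : W b = V b := if_pos hb'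
      simp only [hWb, inv_one, mul_one]
    have h2 : ∑ b ∈ Finset.univ.filter (fun b : PBond P j => ¬((∀ k, (b.src k - x₀ k).val < n) ∧ (∀ k, (b.tgt k - x₀ k).val < n))),
        GaugeGroup.dist1 (W b * ((fun _ => (1 : G)) b)⁻¹) ^ 2 = 0 := by
      refine Finset.sum_eq_zero fun b hb => ?_
      have hb' := (Finset.mem_filter.1 hb).2
      have hWb : W b = 1 := if_neg hb'
      simp only [hWb, inv_one, mul_one, GaugeGroup.dist1_one]
      simp
    rw [h1, h2, add_zero]
  calc |f U - f (fun _ => 1)| = |f W - f (fun _ => 1)| := by rw [hfU]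
    _ ≤ Λ * Real.sqrt (∑ b : PBond P j, GaugeGroup.dist1 (W b * ((fun _ => (1 : G)) b)⁻¹) ^ 2) := hlip W _
    _ = _ := by rw [hsum]

/-- ★★ The same with a displayed bound: if SOME gauge copy has box-bond energy `Σ_{box} dist₁((U^g) b)² ≤ B²` (`0 ≤ B`), then `|f U − f 𝟙| ≤ Λ·B`. [folklore] -/
theorem abs_sub_one_le_of_gauge_sq_le {n : ℕ} (x₀ : Site P j) (f : GaugeField P j G → ℝ) {Λ : ℝ} (hΛ : 0 ≤ Λ)
    (hfG : GaugeField.GaugeInvariant f)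
    (hloc : ∀ U U' : GaugeField P j G,
      (∀ b : PBond P j, (∀ k, (b.src k - x₀ k).val < n) → (∀ k, (b.tgt k - x₀ k).val < n) → U b = U' b) → f U = f U')
    (hlip : ∀ U U' : GaugeField P j G, |f U - f U'| ≤ Λ * Real.sqrt (∑ b : PBond P j, GaugeGroup.dist1 (U b * (U' b)⁻¹) ^ 2))
    (U : GaugeField P j G) (g : GaugeTransf P j G) {B : ℝ} (hB : 0 ≤ B)
    (hD : ∑ b ∈ Finset.univ.filter
      (fun b : PBond P j => (∀ k, (b.src k - x₀ k).val < n) ∧ (∀ k, (b.tgt k - x₀ k).val < n)),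
        GaugeGroup.dist1 (GaugeField.gaugeAct g U b) ^ 2 ≤ B ^ 2) :
    |f U - f (fun _ => 1)| ≤ Λ * B := by
  refine (abs_sub_one_le_sqrt_sum_gaugeAct x₀ f hfG hloc hlip U g).trans (mul_le_mul_of_nonneg_left ?_ hΛ)
  calc Real.sqrt _ ≤ Real.sqrt (B ^ 2) := Real.sqrt_le_sqrt hD
    _ = B := Real.sqrt_sq hB

/-- ★★ NP's currency: if some gauge copy has box-bond energy `≤ (C·n)²·S` (`0 ≤ C`, `0 ≤ S`), then `|f U − f 𝟙| ≤ Λ·(C·n)·√S`. [folklore] -/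
theorem abs_sub_one_le_curvature_form {n : ℕ} (x₀ : Site P j) (f : GaugeField P j G → ℝ) {Λ : ℝ} (hΛ : 0 ≤ Λ)
    (hfG : GaugeField.GaugeInvariant f)
    (hloc : ∀ U U' : GaugeField P j G,
      (∀ b : PBond P j, (∀ k, (b.src k - x₀ k).val < n) → (∀ k, (b.tgt k - x₀ k).val < n) → U b = U' b) → f U = f U')
    (hlip : ∀ U U' : GaugeField P j G, |f U - f U'| ≤ Λ * Real.sqrt (∑ b : PBond P j, GaugeGroup.dist1 (U b * (U' b)⁻¹) ^ 2))
    (U : GaugeField P j G) (g : GaugeTransf P j G) {C S : ℝ} (hC : 0 ≤ C) (hS : 0 ≤ S)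
    (hD : ∑ b ∈ Finset.univ.filter
      (fun b : PBond P j => (∀ k, (b.src k - x₀ k).val < n) ∧ (∀ k, (b.tgt k - x₀ k).val < n)),
        GaugeGroup.dist1 (GaugeField.gaugeAct g U b) ^ 2 ≤ (C * (n : ℝ)) ^ 2 * S) :
    |f U - f (fun _ => 1)| ≤ Λ * (C * (n : ℝ)) * Real.sqrt S := by
  have hB : 0 ≤ C * (n : ℝ) * Real.sqrt S := by positivity
  have hD' : ∑ b ∈ Finset.univ.filter
      (fun b : PBond P j => (∀ k, (b.src k - x₀ k).val < n) ∧ (∀ k, (b.tgt k - x₀ k).val < n)),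
        GaugeGroup.dist1 (GaugeField.gaugeAct g U b) ^ 2 ≤ (C * (n : ℝ) * Real.sqrt S) ^ 2 := by
    rw [mul_pow, Real.sq_sqrt hS]; exact hD
  have h := abs_sub_one_le_of_gauge_sq_le x₀ f hΛ hfG hloc hlip U g hB hD'
  linarith [h]

end Generic

/-! ## §2 The member `F.P K`: the ideator's bookkeeping half of NP, `stub_pinning_of_boxUhlenbeck`, AS TYPED in
`Cruxes/HistoryTailL/Lines/curvature_poincare_planNP.lean` (ym-r3-idea-2 g16, 19:30Z; NOT a registered stub — a helper): BOX-UHLENBECK ⟹ NP -/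

section Member

open Literature.MathematicalPhysics.QuantumFieldTheory.Balaban1983to89.T4AxialGaugeSmallField (boxPlaqs)

open Classical in
/-- ★★★ **BOX-UHLENBECK ⟹ CURVATURE PINNING** (the ideator's `stub_pinning_of_boxUhlenbeck`, statement token for token): if some absolute `C > 0` bounds, for
every box (`1 ≤ n`, `2n ≤ sitesPerDir 0`) and every `U`, the box-bond energy of SOME gauge copy by `(C·n)²·Σ_{p ∈ boxPlaqs} dist₁(U(∂p))²`, then the
registered NP text `stub_curvaturePinning` holds with the same `C`.  Proof: §1 `abs_sub_one_le_curvature_form` at the gauge the hypothesis provides. [folklore] -/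
theorem pinning_of_boxUhlenbeck :
    (∃ C : ℝ, 0 < C ∧ ∀ (F : T3Family) (K n : ℕ) (x₀ : Site (F.P K) 0), 1 ≤ n → 2 * n ≤ (F.P K).sitesPerDir 0 →
      ∀ U : GaugeField (F.P K) 0 (Matrix.specialUnitaryGroup (Fin 2) ℂ), ∃ g : GaugeTransf (F.P K) 0 (Matrix.specialUnitaryGroup (Fin 2) ℂ),
        (∑ b ∈ Finset.univ.filter (fun b : PBond (F.P K) 0 => (∀ k, (b.src k - x₀ k).val < n) ∧ (∀ k, (b.tgt k - x₀ k).val < n)), GaugeGroup.dist1 (GaugeField.gaugeAct g U b) ^ 2)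
          ≤ (C * (n : ℝ)) ^ 2 * (∑ p ∈ Finset.univ.filter (fun p : Plaq (F.P K) 0 => p ∈ boxPlaqs (P := F.P K) (j := 0) (fun k => ((x₀ k).val : ℤ)) (fun k => ((x₀ k).val : ℤ) + ((n : ℤ) - 1))), GaugeGroup.dist1 (GaugeField.plaqHol U p) ^ 2)) →
        ∃ C : ℝ, 0 < C ∧ ∀ (F : T3Family) (K n : ℕ) (x₀ : Site (F.P K) 0)
      (f : GaugeField (F.P K) 0 (Matrix.specialUnitaryGroup (Fin 2) ℂ) → ℝ) (Λ : ℝ), 0 ≤ Λ → 1 ≤ n → 2 * n ≤ (F.P K).sitesPerDir 0 →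
      GaugeField.GaugeInvariant f →
      (∀ U U' : GaugeField (F.P K) 0 (Matrix.specialUnitaryGroup (Fin 2) ℂ),
        (∀ b : PBond (F.P K) 0, (∀ k, (b.src k - x₀ k).val < n) → (∀ k, (b.tgt k - x₀ k).val < n) → U b = U' b) → f U = f U') →
      (∀ U U' : GaugeField (F.P K) 0 (Matrix.specialUnitaryGroup (Fin 2) ℂ),
        |f U - f U'| ≤ Λ * Real.sqrt (∑ b : PBond (F.P K) 0, GaugeGroup.dist1 (U b * (U' b)⁻¹) ^ 2)) →
      ∀ U : GaugeField (F.P K) 0 (Matrix.specialUnitaryGroup (Fin 2) ℂ),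
        |f U - f (fun _ => 1)| ≤ Λ * (C * (n : ℝ)) * Real.sqrt (∑ p ∈ Finset.univ.filter (fun p : Plaq (F.P K) 0 => p ∈ boxPlaqs (P := F.P K) (j := 0) (fun k => ((x₀ k).val : ℤ)) (fun k => ((x₀ k).val : ℤ) + ((n : ℤ) - 1))), GaugeGroup.dist1 (GaugeField.plaqHol U p) ^ 2) := by
  rintro ⟨C, hC, hU⟩
  refine ⟨C, hC, fun F K n x₀ f Λ hΛ hn h2n hfG hloc hlip U => ?_⟩
  obtain ⟨g, hg⟩ := hU F K n x₀ hn h2n U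
  exact abs_sub_one_le_curvature_form x₀ f hΛ hfG hloc hlip U g hC.le (Finset.sum_nonneg fun p _ => by positivity) hg

end Member

/-! ## §3 The generic CONGESTION Cauchy–Schwarz row (ladders `S b` of length `≤ m`, plaquette congestion `≤ cong p`) -/

section Congestion

variable {ι κ : Type*}

/-- ★★ **CONGESTION CAUCHY–SCHWARZ.**  If `0 ≤ a b ≤ Σ_{p ∈ S b} c p` with ladders of size `#S b ≤ m`, and every `p` lies on at most `cong p` ladders, then
`Σ_{b∈B} (a b)² ≤ m · Σ_{p ∈ ⋃_b S b} cong p · (c p)²`. [folklore] -/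
theorem sum_sq_le_of_ladders [DecidableEq ι] [DecidableEq κ] (B : Finset ι) (S : ι → Finset κ) (a : ι → ℝ) (c : κ → ℝ) (m : ℕ) (cong : κ → ℕ)
    (ha : ∀ b ∈ B, 0 ≤ a b) (hle : ∀ b ∈ B, a b ≤ ∑ p ∈ S b, c p) (hm : ∀ b ∈ B, (S b).card ≤ m)
    (hcong : ∀ p ∈ B.biUnion S, (B.filter fun b => p ∈ S b).card ≤ cong p) :
    ∑ b ∈ B, a b ^ 2 ≤ (m : ℝ) * ∑ p ∈ B.biUnion S, (cong p : ℝ) * c p ^ 2 := by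
  -- per ladder: `(a b)² ≤ (Σ_{S b} c)² ≤ #S b · Σ_{S b} c² ≤ m · Σ_{S b} c²`
  have hb : ∀ b ∈ B, a b ^ 2 ≤ (m : ℝ) * ∑ p ∈ S b, c p ^ 2 := by
    intro b hbB
    have h1 : a b ^ 2 ≤ (∑ p ∈ S b, c p) ^ 2 := pow_le_pow_left₀ (ha b hbB) (hle b hbB) 2
    have h2 : (∑ p ∈ S b, c p) ^ 2 ≤ ((S b).card : ℝ) * ∑ p ∈ S b, c p ^ 2 := sq_sum_le_card_mul_sum_sq
    have h3 : ((S b).card : ℝ) * ∑ p ∈ S b, c p ^ 2 ≤ (m : ℝ) * ∑ p ∈ S b, c p ^ 2 :=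
      mul_le_mul_of_nonneg_right (by exact_mod_cast hm b hbB) (Finset.sum_nonneg fun p _ => sq_nonneg _)
    linarith
  -- exchange of summation: `Σ_b Σ_{p ∈ S b} c p² = Σ_p #{b | p ∈ S b} · c p²`
  have hex : ∑ b ∈ B, ∑ p ∈ S b, c p ^ 2 = ∑ p ∈ B.biUnion S, ((B.filter fun b => p ∈ S b).card : ℝ) * c p ^ 2 := by
    rw [Finset.sum_comm' (t' := B.biUnion S) (s' := fun p => B.filter fun b => p ∈ S b)]
    · refine Finset.sum_congr rfl fun p _ => ?_
      rw [Finset.sum_const, nsmul_eq_mul]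
    · intro b p
      simp only [Finset.mem_filter, Finset.mem_biUnion]
      constructor
      · rintro ⟨hbB, hp⟩; exact ⟨⟨hbB, hp⟩, b, hbB, hp⟩
      · rintro ⟨⟨hbB, hp⟩, -⟩; exact ⟨hbB, hp⟩
  calc ∑ b ∈ B, a b ^ 2 ≤ ∑ b ∈ B, (m : ℝ) * ∑ p ∈ S b, c p ^ 2 := Finset.sum_le_sum hb
    _ = (m : ℝ) * ∑ p ∈ B.biUnion S, ((B.filter fun b => p ∈ S b).card : ℝ) * c p ^ 2 := by rw [← Finset.mul_sum, hex]
    _ ≤ (m : ℝ) * ∑ p ∈ B.biUnion S, (cong p : ℝ) * c p ^ 2 := by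
        refine mul_le_mul_of_nonneg_left (Finset.sum_le_sum fun p hp => ?_) (by positivity)
        exact mul_le_mul_of_nonneg_right (by exact_mod_cast hcong p hp) (sq_nonneg _)

/-- The same against a LARGER plaquette set `Q ⊇ ⋃_b S b` (e.g. all box plaquettes), nonnegative extra terms. [folklore] -/
theorem sum_sq_le_of_ladders_subset [DecidableEq ι] [DecidableEq κ] (B : Finset ι) (S : ι → Finset κ) (Q : Finset κ) (a : ι → ℝ) (c : κ → ℝ)
    (m : ℕ) (cong : κ → ℕ) (ha : ∀ b ∈ B, 0 ≤ a b) (hle : ∀ b ∈ B, a b ≤ ∑ p ∈ S b, c p) (hm : ∀ b ∈ B, (S b).card ≤ m)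
    (hcong : ∀ p ∈ B.biUnion S, (B.filter fun b => p ∈ S b).card ≤ cong p) (hQ : B.biUnion S ⊆ Q) :
    ∑ b ∈ B, a b ^ 2 ≤ (m : ℝ) * ∑ p ∈ Q, (cong p : ℝ) * c p ^ 2 :=
  (sum_sq_le_of_ladders B S a c m cong ha hle hm hcong).trans
    (mul_le_mul_of_nonneg_left (Finset.sum_le_sum_of_subset_of_nonneg hQ fun p _ _ => by positivity) (by positivity))

end Congestion

end Summit.QuantumFields.YangMills.Theorems.CurvaturePoincareGaugeTransfer
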